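import Mathlib
import Literature.NumberTheory.LFunctions.Zhang2022.Section16Eq1610Poles
import Literature.NumberTheory.LFunctions.Zhang2022.Section16Eq1610Bounds
import Literature.NumberTheory.LFunctions.Zhang2022.GaussKernelContour
import Literature.NumberTheory.LFunctions.Zhang2022.Section8Lemma84LBounds
import HarnessLib

/-!
# Zhang (2022), §16 (16.10): the contour shift of the §16.u023 integral to Landau's broken line —
# one modulus, one character, one pair `(d,l)`, all analytic inputs as hypotheses

Topic `Literature/NumberTheory/LFunctions/Zhang2022` (Landau–Siegel audit tree; verdict-neutral).
Y. Zhang, *Discrete mean estimates and the Landau–Siegel zero*, arXiv:2211.02515v1 (2022)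
[Zhang2022LandauSiegel] — **an unrefereed manuscript under adjudication**; nothing here asserts its
Theorems 1–2. DAG node `Z22:(16.10)` [Z22 p.92, tex L4550–L4556]:

> Assume `dl < P₂²`, and `(dl,D) = 1`. Note that `P₄/d > T`. In a way similar to the proof of (15.15),
> we deduce that `𝒟₂(d,l) = λ₂(d) Σ_{j=1,2} ℛ₂ⱼ d^{βⱼ} ℳ₂(d,l;1−βⱼ) + O(ε₁)` (16.10)

(the proof of (15.15), p.85: "In a way similar to the proof of Lemma 8.4 …; the function (15.16) also has
a simple pole at `s = ρ̃ − 1`, while the residue at this point can be regarded as an acceptable error").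

`integral_u023_sub_residues_le_local` is that argument for ONE `(D, χ, d, l)`: the line integral
`(2πi)⁻¹∫_{(1)}` of the integrand of §16.u023 (`Typed.Section16A.integrand16_u023 c′ χ d l`) minus the two
typed residue terms `ℛ₂ⱼ d^{βⱼ} ℳ₂(d,l;1−βⱼ)` (`ℛ₂ⱼ = Typed.Section16A.calR2 c′ χ j`) is bounded by the
explicit remainder of the tree's Gaussian-kernel contour engine
(`GaussKernelContour.norm_lineIntegral_sub_sum_limUnder_le`: tails + left segment `Re s = −η` + two
horizontal sides `Im s = ±H`, singular set `S = {−β₁, −β₂, ρ̃−1, 0}`, pole data from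
`Section16Eq1610Poles`, sup-bounds from `Section16Eq1610Bounds`) PLUS the size of the residue at the
exceptional-zero pole `ρ̃ − 1` (`Eq1610.norm_excZero_residue_le`). Every analytic input is a hypothesis:
the classical region for `ζ` up to height `H + 2`, the zero-free package for `L(·,χ)` with its
exceptional zero `ρ̃`, `‖ℳ₂(d,l;·)‖ ≤ K_M` and its holomorphy on `σ > 9/10` (nodes §16.u022/u021an),
`L(1−βⱼ,χ) ≠ 0`, and the sizes of `β₁, β₂`. The choice of `η, H` and the verification of these inputs
for all large `D` under (A) is the companion file `Section16Eq1610`.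

## References

* Y. Zhang, arXiv:2211.02515v1 (2022), §16 (16.10)–(16.11) p.92; §15 (15.15)–(15.16) p.85; §8 proof
  of Lemma 8.2 p.44. [cite: Zhang2022LandauSiegel, §16 (16.10) p.92]
* H. L. Montgomery, R. C. Vaughan, *Multiplicative Number Theory I*, CUP 2007, §6.2.
  [cite: MontgomeryVaughan2007, §6.2]
-/

noncomputable section

open Complex Real Filter Topology Set MeasureTheory
open Literature.NumberTheory.LFunctions.Zhang2022
open Literature.NumberTheory.LFunctions.Zhang2022.Skeleton
open Literature.NumberTheory.LFunctions.Zhang2022.Typed.Section16A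

namespace Literature.NumberTheory.LFunctions.Zhang2022.Eq1610

/-- `Re β₁ = 0`, `Re β₂ = 0`, `Im β₁ = b₁`, `Im β₂ = b₂`. [cite: Zhang2022LandauSiegel, §2 (2.13)] -/
theorem beta_re_im (c' : ℝ) (D : ℕ) :
    (beta1 c' D).re = 0 ∧ (beta2 c' D).re = 0 ∧ (beta1 c' D).im = b1 c' D ∧
      (beta2 c' D).im = b2 c' D := by
  refine ⟨?_, ?_, ?_, ?_⟩ <;> simp [beta1, beta2, b1, b2]

variable (c' : ℝ) {D : ℕ} [NeZero D] (χ : DirichletCharacter ℂ D) (d l : ℕ)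

/-- **(16.10), the contour argument at one `(D, χ, d, l)`.** Parameters `0 < η ≤ 1/20`, `H ≥ 2`;
`K_M ≥ 0` bounds `ℳ₂(d,l;w)` on `Re w > 9/10` where `ℳ₂(d,l;·)` is holomorphic; the classical region
for `ζ` (`w ≠ 1`, `Re w ≥ 1 − 2η`, `|Im w| ≤ H + 2`: `ζ(w) ≠ 0`, `‖ζ(w) − (w−1)⁻¹‖, ‖ζ(w)⁻¹‖ ≤ B_ζ`); the
zero-free package for `L(·,χ)` with the exceptional real zero `ρ̃ ∈ [1 − η/2, 1)`, `ρ̃ ≥ 0`,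
`L(ρ̃,χ) = 0 ≠ L′(ρ̃,χ)` (`Re s ≥ 1 − 2η`, `|Im s| ≤ H + 1`, `s ≠ ρ̃`: `L(s,χ) ≠ 0`,
`‖L(s,χ)⁻¹‖ ≤ M_inv(1 + |s − ρ̃|⁻¹)`); `‖(ρ̃−1)ζ(ρ̃) − 1‖ ≤ 1/2`; `L(1−βⱼ,χ) ≠ 0`; `0 < b₁, b₂ < 1`,
`b₁ ≠ b₂`, `‖β₁‖ ≤ 1`; `P₄ ≥ 1`, `𝓛 ≥ 1`, `d ≥ 1`, `d^{1−ρ̃} ≤ E`. Then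
`‖(2πi)⁻¹∫_{(1)} integrand − Σ_{j=1,2} ℛ₂ⱼ d^{βⱼ} ℳ₂(d,l;1−βⱼ)‖ ≤ (1/2π)(E_tails + E_left + 2E_horiz) + R₃`
with the engine's pieces at `M₀ = 8K_M`, `M₁ = (η⁻¹ + B_ζ)K_M B_ζ M_inv(1 + 2/η) d^{η}`,
`M₂ = (1 + B_ζ)K_M B_ζ·3M_inv·d`, and `R₃ = M_inv(b₁⁻¹ + B_ζ)K_M·2(1−ρ̃)·E·(e/b₂)`.
[cite: Zhang2022LandauSiegel, §16 (16.10) p.92] [cite: MontgomeryVaughan2007, §6.2] -/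
theorem integral_u023_sub_residues_le_local (hχ : χ ≠ 1) (hd : d ≠ 0) {η H KM Bζ Minv ρt E : ℝ}
    (hη : 0 < η) (hη20 : η ≤ 1 / 20) (hH : 2 ≤ H) (hell : 1 ≤ ell D) (hP : 1 ≤ P4 D)
    (hb1 : 0 < b1 c' D) (hb1' : b1 c' D < 1) (hb2 : 0 < b2 c' D) (hb2' : b2 c' D < 1)
    (hb12 : b1 c' D ≠ b2 c' D) (hβ1n : ‖beta1 c' D‖ ≤ 1)
    (hM_diff : DifferentiableOn ℂ (calM2 c' χ d l) {s : ℂ | 9 / 10 < s.re}) (hKM : 0 ≤ KM)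
    (hM_bd : ∀ w : ℂ, 9 / 10 < w.re → ‖calM2 c' χ d l w‖ ≤ KM) (hBζ : 0 ≤ Bζ)
    (hζpk : ∀ w : ℂ, w ≠ 1 → 1 - 2 * η ≤ w.re → |w.im| ≤ H + 2 →
      riemannZeta w ≠ 0 ∧ ‖riemannZeta w - (w - 1)⁻¹‖ ≤ Bζ ∧ ‖(riemannZeta w)⁻¹‖ ≤ Bζ)
    (hMinv : 0 < Minv) (hρ0 : 0 ≤ ρt) (hρ1 : ρt < 1) (hρη : 1 - η / 2 ≤ ρt)
    (hLρ : χ.LFunction ρt = 0) (hL'ρ : deriv χ.LFunction ρt ≠ 0)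
    (hLpk : ∀ s : ℂ, 1 - 2 * η ≤ s.re → |s.im| ≤ H + 1 → s ≠ (ρt : ℂ) →
      χ.LFunction s ≠ 0 ∧ ‖(χ.LFunction s)⁻¹‖ ≤ Minv * (1 + ‖s - ρt‖⁻¹))
    (hζρ : ‖((ρt : ℂ) - 1) * riemannZeta ρt - 1‖ ≤ 1 / 2)
    (hL1 : χ.LFunction (1 - beta1 c' D) ≠ 0) (hL2 : χ.LFunction (1 - beta2 c' D) ≠ 0)
    (hE : (d : ℝ) ^ (1 - ρt) ≤ E) :
    ‖(1 / (2 * π) : ℂ) * (∫ t : ℝ, integrand16_u023 c' χ d l (1 + t * I)) -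
        ∑ j ∈ ({1, 2} : Finset ℕ),
          calR2 c' χ j * (d : ℂ) ^ betaJ c' D j * calM2 c' χ d l (1 - betaJ c' D j)‖ ≤
      1 / (2 * π) *
        (2 * (8 * KM * (P4 D ^ (1 : ℝ) * rexp ((1 : ℝ) ^ 2 / (4 * ell D ^ 30)) / |(1 : ℝ)|) *
            (GaussWeight.gauss (4 * ell D ^ 30)⁻¹ (H - |b2 c' D|) *
              (Real.sqrt (4 * π * ell D ^ 30) / 2))) +
          (η⁻¹ + Bζ) * KM * Bζ * (Minv * (1 + 2 / η)) * (d : ℝ) ^ η *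
            (P4 D ^ (-η) * rexp ((-η) ^ 2 / (4 * ell D ^ 30)) / |(-η)|) *
            Real.sqrt (4 * π * ell D ^ 30) +
          2 * ((1 - -η) * ((1 + Bζ) * KM * Bζ * (Minv * 3) * (d : ℝ) ^ (1 : ℝ) *
            (max (P4 D ^ (-η)) (P4 D ^ (1 : ℝ)) * rexp (max ((-η) ^ 2) ((1 : ℝ) ^ 2) / (4 * ell D ^ 30)) *
              GaussWeight.gauss (4 * ell D ^ 30)⁻¹ (H - |b2 c' D|) / (H - |b2 c' D|))))) +
      Minv * ((b1 c' D)⁻¹ + Bζ) * KM * (2 * (1 - ρt)) * E * (Real.exp 1 / b2 c' D) := by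
  classical
  obtain ⟨hβ1re, hβ2re, hβ1im, hβ2im⟩ := beta_re_im c' D
  have hP0 : 0 < P4 D := by linarith
  have hΛ : 0 < ell D ^ 30 := by positivity
  have hΛ1 : 1 ≤ ell D ^ 30 := one_le_pow₀ hell
  -- the shifts
  have hβ1ne : beta1 c' D ≠ 0 := by
    intro h; have := congrArg Complex.im h; rw [hβ1im, Complex.zero_im] at this; linarith
  have hβ2ne : beta2 c' D ≠ 0 := by
    intro h; have := congrArg Complex.im h; rw [hβ2im, Complex.zero_im] at this; linarith
  have hβ12 : beta1 c' D ≠ beta2 c' D := by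
    intro h; have := congrArg Complex.im h; rw [hβ1im, hβ2im] at this; exact hb12 this
  have hζ1 : riemannZeta (1 - beta1 c' D) ≠ 0 :=
    riemannZeta_ne_zero_of_one_le_re (by simp [hβ1re])
  have hζ2 : riemannZeta (1 - beta2 c' D) ≠ 0 :=
    riemannZeta_ne_zero_of_one_le_re (by simp [hβ2re])
  -- `ℳ₂` continuous / differentiable at the points `1 + z`, `Re z > −1/10`
  have hopen : IsOpen {s : ℂ | 9 / 10 < s.re} := isOpen_lt continuous_const Complex.continuous_re
  have hMd : ∀ z : ℂ, -(1 / 10 : ℝ) < z.re →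
      DifferentiableAt ℂ (fun s : ℂ => calM2 c' χ d l (1 + s)) z := by
    intro z hz
    have hmem : (1 + z) ∈ {s : ℂ | 9 / 10 < s.re} := by
      show 9 / 10 < (1 + z).re; simp; linarith
    exact (hM_diff.differentiableAt (hopen.mem_nhds hmem)).comp z (by fun_prop)
  have hMc : ∀ z : ℂ, -(1 / 10 : ℝ) < z.re →
      ContinuousAt (fun s : ℂ => calM2 c' χ d l (1 + s)) z := fun z hz => (hMd z hz).continuousAt
  -- the exceptional point `u₁ = ρ̃ − 1`
  set u₁ : ℂ := ((ρt - 1 : ℝ) : ℂ) with hu₁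
  have hu₁' : u₁ = (ρt : ℂ) - 1 := by rw [hu₁]; push_cast; ring
  have hu₁re : u₁.re = ρt - 1 := by rw [hu₁]; simp
  have hu₁im : u₁.im = 0 := by rw [hu₁]; simp
  -- `ζ(ρ̃) ≠ 0`
  have hζρne : riemannZeta ρt ≠ 0 := by
    intro h
    rw [h, mul_zero, zero_sub, norm_neg, norm_one] at hζρ
    norm_num at hζρ
  -- the regular factor `Φ` and the kernel `K`
  set Φ : ℂ → ℂ := fun s => riemannZeta (1 + s + beta1 c' D) * calM2 c' χ d l (1 + s) /
    (riemannZeta (1 + s) * χ.LFunction (1 + s)) * ((d : ℂ) ^ s)⁻¹ with hΦdef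
  have hfun : ∀ s : ℂ, Φ s * (((P4 D : ℝ) : ℂ) ^ (s + beta2 c' D) *
      GaussWeight.omega1 (ell D ^ 30) (s + beta2 c' D) / (s + beta2 c' D)) =
      integrand16_u023 c' χ d l s := fun s => by
    rw [hΦdef, integrand16_u023_eq_mul_kernel]
  have hfunext : (fun s : ℂ => Φ s * (((P4 D : ℝ) : ℂ) ^ (s + beta2 c' D) *
      GaussWeight.omega1 (ell D ^ 30) (s + beta2 c' D) / (s + beta2 c' D))) =
      integrand16_u023 c' χ d l := funext hfun
  -- the bounds `M₀, M₁, M₂`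
  have hM2right : ∀ w : ℂ, 2 ≤ w.re → ‖calM2 c' χ d l w‖ ≤ KM := fun w hw => hM_bd w (by linarith)
  have hζ2right : ∀ w : ℂ, 2 ≤ w.re → ‖riemannZeta w‖ ≤ 2 ∧ ‖(riemannZeta w)⁻¹‖ ≤ 2 := by
    intro w hw
    have hw1 : 1 < w.re := by linarith
    constructor
    · refine (ZetaClassicalRegion.norm_riemannZeta_le_of_one_lt_re hw1).trans ?_
      rw [div_le_iff₀ (by linarith)]; linarith
    · refine (ZetaClassicalRegion.norm_inv_riemannZeta_le_of_one_lt_re hw1).trans ?_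
      rw [div_le_iff₀ (by linarith)]; linarith
  have hL2right : ∀ w : ℂ, 2 ≤ w.re → ‖(χ.LFunction w)⁻¹‖ ≤ 2 := by
    intro w hw
    have h := (Literature.NumberTheory.LFunctions.Zhang2022.Lemma84.inv_LFunction_le_right χ (a := 1)
      one_pos (by linarith)).2
    have h2 : ((1 : ℝ) + 1) / 1 = 2 := by norm_num
    rw [h2] at h
    exact h
  have hMleft : ∀ w : ℂ, 1 - η ≤ w.re → ‖calM2 c' χ d l w‖ ≤ KM := fun w hw => hM_bd w (by linarith)
  have hζpk' : ∀ w : ℂ, w ≠ 1 → 1 - 2 * η ≤ w.re → |w.im| ≤ H + 2 →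
      ‖riemannZeta w - (w - 1)⁻¹‖ ≤ Bζ ∧ ‖(riemannZeta w)⁻¹‖ ≤ Bζ := fun w h1 h2 h3 => (hζpk w h1 h2 h3).2
  have hΦ₀ : ∀ t : ℝ, H ≤ |t| → ‖Φ (((1 : ℝ) : ℂ) + t * I)‖ ≤ 8 * KM := fun t _ =>
    norm_Phi_line_le χ (fun w => calM2 c' χ d l w) (beta1 c' D) hd hβ1re hKM hM2right hζ2right
      hL2right (by simp)
  have hΦline : ∀ t : ℝ, ‖Φ (((1 : ℝ) : ℂ) + t * I)‖ ≤ 8 * KM := fun t =>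
    norm_Phi_line_le χ (fun w => calM2 c' χ d l w) (beta1 c' D) hd hβ1re hKM hM2right hζ2right
      hL2right (by simp)
  have hΦ₁ : ∀ t : ℝ, |t| ≤ H →
      ‖Φ (((-η : ℝ) : ℂ) + t * I)‖ ≤ (η⁻¹ + Bζ) * KM * Bζ * (Minv * (1 + 2 / η)) * (d : ℝ) ^ η :=
    fun t ht => norm_Phi_left_le χ (fun w => calM2 c' χ d l w) (beta1 c' D) hd hη hβ1re hβ1n hKM
      hMleft hBζ hζpk' hMinv.le hLpk hρη ht
  have hΦ₂ : ∀ u : ℝ, -η ≤ u → u ≤ 1 →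
      ‖Φ ((u : ℂ) + (H : ℂ) * I)‖ ≤ (1 + Bζ) * KM * Bζ * (Minv * 3) * (d : ℝ) ^ (1 : ℝ) ∧
      ‖Φ ((u : ℂ) + ((-H : ℝ) : ℂ) * I)‖ ≤ (1 + Bζ) * KM * Bζ * (Minv * 3) * (d : ℝ) ^ (1 : ℝ) := by
    intro u hu1 _
    have hη1 : η ≤ 1 := by linarith
    constructor
    · exact norm_Phi_horiz_le χ (fun w => calM2 c' χ d l w) (beta1 c' D) hd hη hη1 hH hβ1re hβ1n
        hKM hMleft hBζ hζpk' hMinv.le hLpk hu1 (abs_of_nonneg (by linarith))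
    · exact norm_Phi_horiz_le χ (fun w => calM2 c' χ d l w) (beta1 c' D) hd hη hη1 hH hβ1re hβ1n
        hKM hMleft hBζ hζpk' hMinv.le hLpk hu1 (by rw [abs_neg, abs_of_nonneg (by linarith)])
  -- continuity of `Φ` along `Re s = 1` and integrability
  have hcont : Continuous fun t : ℝ => Φ (((1 : ℝ) : ℂ) + t * I) := by
    refine continuous_iff_continuousAt.2 fun t => ?_
    set z : ℂ := ((1 : ℝ) : ℂ) + t * I with hz
    have hzre : z.re = 1 := by simp [hz]
    have hz1 : z + beta1 c' D ≠ 0 := by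
      intro h; have := congrArg Complex.re h; simp [hzre, hβ1re] at this
    have hz0 : z ≠ 0 := by
      intro h; have := congrArg Complex.re h; simp [hzre] at this
    have hwre : 1 < (1 + z).re := by simp [hzre]
    have hζz : riemannZeta (1 + z) ≠ 0 := riemannZeta_ne_zero_of_one_le_re hwre.le
    have hLz : χ.LFunction (1 + z) ≠ 0 :=
      DirichletCharacter.LFunction_ne_zero_of_one_le_re χ (Or.inr (by
        intro h; have := congrArg Complex.re h; simp [hzre] at this)) hwre.le
    have hc := continuousAt_Phi (l := l) hχ hd hz1 hz0 hζz hLz (hMc z (by rw [hzre]; norm_num))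
    exact hc.comp (f := fun t : ℝ => ((1 : ℝ) : ℂ) + t * I) (by fun_prop)
  have hint := GaussKernelContour.integrable_integrand_line (Φ := Φ) (β := beta2 c' D) hΛ hP0
    (σ := 1) (M := 8 * KM) (by rw [hβ2re]; norm_num) hcont hΦline
  -- the singular set and the open neighbourhood
  set S : Finset ℂ := {-beta1 c' D, -beta2 c' D, u₁, 0} with hSdef
  set U : Set ℂ := Ioo (-(2 * η)) 2 ×ℂ Ioo (-(H + 1)) (H + 1) with hUdef
  have hUo : IsOpen U := isOpen_Ioo.reProdIm isOpen_Ioo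
  have hKU : Icc (-η) 1 ×ℂ Icc (-H) H ⊆ U := by
    intro z hz
    rw [mem_reProdIm] at hz ⊢
    exact ⟨⟨by linarith [hz.1.1], by linarith [hz.1.2]⟩, ⟨by linarith [hz.2.1], by linarith [hz.2.2]⟩⟩
  have hSsub : (S : Set ℂ) ⊆ Ioo (-η) 1 ×ℂ Ioo (-H) H := by
    intro p hp
    simp only [hSdef, Finset.coe_insert, Finset.coe_singleton, Set.mem_insert_iff,
      Set.mem_singleton_iff] at hp
    rw [mem_reProdIm]
    rcases hp with rfl | rfl | rfl | rfl
    · simp only [Complex.neg_re, Complex.neg_im, hβ1re, hβ1im, neg_zero]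
      exact ⟨⟨by linarith, by linarith⟩, ⟨by linarith, by linarith⟩⟩
    · simp only [Complex.neg_re, Complex.neg_im, hβ2re, hβ2im, neg_zero]
      exact ⟨⟨by linarith, by linarith⟩, ⟨by linarith, by linarith⟩⟩
    · rw [hu₁re, hu₁im]
      exact ⟨⟨by linarith, by linarith⟩, ⟨by linarith, by linarith⟩⟩
    · simp only [Complex.zero_re, Complex.zero_im]
      exact ⟨⟨by linarith, by linarith⟩, ⟨by linarith, by linarith⟩⟩
  -- holomorphy on `U ∖ S`
  have hG : DifferentiableOn ℂ (fun s : ℂ => Φ s * (((P4 D : ℝ) : ℂ) ^ (s + beta2 c' D) *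
      GaussWeight.omega1 (ell D ^ 30) (s + beta2 c' D) / (s + beta2 c' D))) (U \ ↑S) := by
    rw [hfunext]
    intro z hz
    obtain ⟨hzU, hzS⟩ := hz
    have hzS' : z ≠ -beta1 c' D ∧ z ≠ -beta2 c' D ∧ z ≠ u₁ ∧ z ≠ 0 := by
      simpa only [hSdef, Finset.coe_insert, Finset.coe_singleton, Set.mem_insert_iff,
        Set.mem_singleton_iff, not_or] using hzS
    obtain ⟨hz1, hz2, hz3, hz0⟩ := hzS'
    rw [hUdef, mem_reProdIm] at hzU
    obtain ⟨⟨hzr1, hzr2⟩, ⟨hzi1, hzi2⟩⟩ := hzU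
    have hz1' : z + beta1 c' D ≠ 0 := fun h => hz1 (by linear_combination h)
    have hz2' : z + beta2 c' D ≠ 0 := fun h => hz2 (by linear_combination h)
    have hw1 : (1 : ℂ) + z ≠ 1 := fun h => hz0 (by linear_combination h)
    have hwre : 1 - 2 * η ≤ (1 + z).re := by simp; linarith
    have hwim : |(1 + z).im| ≤ H + 1 := by
      simp only [Complex.add_im, Complex.one_im, zero_add]
      rw [abs_le]; constructor <;> linarith
    have hζz : riemannZeta (1 + z) ≠ 0 := (hζpk (1 + z) hw1 hwre (by linarith)).1
    have hzρ : (1 : ℂ) + z ≠ (ρt : ℂ) := by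
      intro h; apply hz3; rw [hu₁']; linear_combination h
    have hLz : χ.LFunction (1 + z) ≠ 0 := (hLpk (1 + z) hwre hwim hzρ).1
    exact (differentiableAt_integrand (l := l) hχ hd hP0 hz1' hz0 hz2' hζz hLz
      (hMd z (by linarith))).differentiableWithinAt
  -- the punctured limits at the four points
  have hlim1 := tendsto_integrand_neg_beta1 (l := l) hχ hP0 hd hβ1ne hβ12 hζ1 hL1
    (hMc _ (by simp [hβ1re]))
  have hlim2 := tendsto_integrand_neg_beta2 (l := l) hχ hP0 hd hβ2ne hβ12 hζ2 hL2
    (hMc _ (by simp [hβ2re]))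
  have hlim0 := tendsto_integrand_zero (l := l) hχ hP0 hd hβ1ne hβ2ne (hMc 0 (by simp))
  have hρt1 : (ρt : ℂ) ≠ 1 := by
    intro h; have := congrArg Complex.re h; simp at this; linarith
  have hu1b1 : (ρt : ℂ) - 1 + beta1 c' D ≠ 0 := by
    intro h; have := congrArg Complex.im h; simp [hβ1im] at this; linarith
  have hu1b2 : (ρt : ℂ) - 1 + beta2 c' D ≠ 0 := by
    intro h; have := congrArg Complex.im h; simp [hβ2im] at this; linarith
  have hLρ' : χ.LFunction (ρt : ℂ) = 0 := hLρ
  have hlim3 := tendsto_integrand_excZero (l := l) hχ hP0 hd hLρ' hL'ρ hρt1 hζρne hu1b1 hu1b2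
    (hMc _ (by simp; linarith))
  rw [← hu₁'] at hlim3
  have hlim : ∀ p ∈ S, ∃ r : ℂ, Tendsto (fun z => (z - p) * (Φ z *
      (((P4 D : ℝ) : ℂ) ^ (z + beta2 c' D) * GaussWeight.omega1 (ell D ^ 30) (z + beta2 c' D) /
        (z + beta2 c' D)))) (𝓝[≠] p) (𝓝 r) := by
    intro p hp
    simp only [hfun]
    simp only [hSdef, Finset.mem_insert, Finset.mem_singleton] at hp
    rcases hp with rfl | rfl | rfl | rfl
    · exact ⟨_, hlim1⟩
    · exact ⟨_, hlim2⟩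
    · exact ⟨_, hlim3⟩
    · exact ⟨_, hlim0⟩
  -- the engine
  have hb2abs : |(beta2 c' D).im| < H := by rw [hβ2im, abs_of_pos hb2]; linarith
  have key := GaussKernelContour.norm_lineIntegral_sub_sum_limUnder_le (Φ := Φ) (β := beta2 c' D)
    hΛ hP0 (a := -η) (σ₀ := 1) (H := H) (by linarith) hb2abs (by rw [hβ2re]; linarith)
    (by rw [hβ2re]; norm_num) (by positivity) (by positivity) (by positivity) hΦ₀ hΦ₁ hΦ₂ hint S U
    hUo hKU hSsub hG hlim
  -- the residues in the typed shape
  have hS1 : -beta1 c' D ∉ ({-beta2 c' D, u₁, 0} : Finset ℂ) := by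
    simp only [Finset.mem_insert, Finset.mem_singleton, not_or]
    refine ⟨fun h => hβ12 (neg_injective h), fun h => ?_, fun h => hβ1ne (neg_eq_zero.mp h)⟩
    have := congrArg Complex.im h; rw [Complex.neg_im, hβ1im, hu₁im] at this; linarith
  have hS2 : -beta2 c' D ∉ ({u₁, 0} : Finset ℂ) := by
    simp only [Finset.mem_insert, Finset.mem_singleton, not_or]
    refine ⟨fun h => ?_, fun h => hβ2ne (neg_eq_zero.mp h)⟩
    have := congrArg Complex.im h; rw [Complex.neg_im, hβ2im, hu₁im] at this; linarith
  have hS3 : u₁ ∉ ({0} : Finset ℂ) := by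
    simp only [Finset.mem_singleton]
    intro h; have := congrArg Complex.re h; rw [hu₁re, Complex.zero_re] at this; linarith
  have hsum : ∑ p ∈ S, limUnder (𝓝[≠] p) (fun z => (z - p) * (Φ z *
      (((P4 D : ℝ) : ℂ) ^ (z + beta2 c' D) * GaussWeight.omega1 (ell D ^ 30) (z + beta2 c' D) /
        (z + beta2 c' D)))) =
      calR2 c' χ 1 * (d : ℂ) ^ beta1 c' D * calM2 c' χ d l (1 - beta1 c' D) +
      calR2 c' χ 2 * (d : ℂ) ^ beta2 c' D * calM2 c' χ d l (1 - beta2 c' D) +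
      (deriv χ.LFunction ρt)⁻¹ *
        (riemannZeta (ρt + beta1 c' D) * calM2 c' χ d l ρt * (riemannZeta ρt)⁻¹ *
          ((d : ℂ) ^ ((ρt : ℂ) - 1))⁻¹ *
          (((P4 D : ℝ) : ℂ) ^ ((ρt : ℂ) - 1 + beta2 c' D) *
            GaussWeight.omega1 (ell D ^ 30) ((ρt : ℂ) - 1 + beta2 c' D) / ((ρt : ℂ) - 1 + beta2 c' D))) +
      0 := by
    simp only [hfun]
    rw [hSdef, Finset.sum_insert hS1, Finset.sum_insert hS2, Finset.sum_insert hS3,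
      Finset.sum_singleton, hlim1.limUnder_eq, hlim2.limUnder_eq, hlim3.limUnder_eq,
      hlim0.limUnder_eq]
    rw [hu₁']
    ring
  -- the typed main term
  have hmain : ∑ j ∈ ({1, 2} : Finset ℕ),
      calR2 c' χ j * (d : ℂ) ^ betaJ c' D j * calM2 c' χ d l (1 - betaJ c' D j) =
      calR2 c' χ 1 * (d : ℂ) ^ beta1 c' D * calM2 c' χ d l (1 - beta1 c' D) +
      calR2 c' χ 2 * (d : ℂ) ^ beta2 c' D * calM2 c' χ d l (1 - beta2 c' D) := by
    rw [Finset.sum_pair (by norm_num : (1 : ℕ) ≠ 2), ResidueValues.betaJ_one, ResidueValues.betaJ_two]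
  -- the integral in the typed shape
  have hintegral : (∫ t : ℝ, Φ (((1 : ℝ) : ℂ) + t * I) *
      (((P4 D : ℝ) : ℂ) ^ ((((1 : ℝ) : ℂ) + t * I) + beta2 c' D) *
        GaussWeight.omega1 (ell D ^ 30) ((((1 : ℝ) : ℂ) + t * I) + beta2 c' D) /
        ((((1 : ℝ) : ℂ) + t * I) + beta2 c' D))) =
      ∫ t : ℝ, integrand16_u023 c' χ d l (1 + t * I) := by
    refine integral_congr_ae (Eventually.of_forall fun t => ?_)
    simp only [hfun, Complex.ofReal_one]
  -- the residue at the exceptional zero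
  have hLinv : ‖(deriv χ.LFunction ρt)⁻¹‖ ≤ Minv := by
    refine norm_inv_deriv_le_of_inv_bound χ hMinv one_pos hLρ' ?_ hL'ρ (fun s hs1 hs2 => ?_)
    · exact (DirichletCharacter.differentiable_LFunction hχ _)
    · have h := hLpk (s : ℂ) (by simp; linarith) (by simp; linarith)
        (by intro h; have := congrArg Complex.re h; simp at this; linarith)
      refine ⟨h.1, ?_⟩
      have : ‖(s : ℂ) - ρt‖ = |s - ρt| := by
        rw [← Complex.ofReal_sub, Complex.norm_real, Real.norm_eq_abs]
      rw [← this]; exact h.2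
  have hζ1β : ‖riemannZeta (ρt + beta1 c' D) - ((ρt : ℂ) + beta1 c' D - 1)⁻¹‖ ≤ Bζ := by
    have hw1 : (ρt : ℂ) + beta1 c' D ≠ 1 := by
      intro h; have := congrArg Complex.im h; simp [hβ1im] at this; linarith
    exact (hζpk _ hw1 (by simp [hβ1re]; linarith) (by simp [hβ1im, abs_of_pos hb1]; linarith)).2.1
  have hR3 := norm_excZero_residue_le χ (fun w => calM2 c' χ d l w) hd (P := P4 D)
    (Λ := ell D ^ 30) hρ0 hρ1 hP hΛ1 hβ2re (by rw [hβ1im]; exact hb1) (by rw [hβ2im]; exact hb2)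
    hLinv hMinv.le hζ1β hBζ hζρ (hM_bd ρt (by simp; linarith)) hKM hE
  rw [hβ1im, hβ2im] at hR3
  -- assemble
  rw [hmain, ← hintegral]
  rw [hsum, hβ2re, hβ2im] at key
  simp only [add_zero] at key
  set Ipart := (1 / (2 * π) : ℂ) * ∫ t : ℝ, Φ (((1 : ℝ) : ℂ) + t * I) *
      (((P4 D : ℝ) : ℂ) ^ ((((1 : ℝ) : ℂ) + t * I) + beta2 c' D) *
        GaussWeight.omega1 (ell D ^ 30) ((((1 : ℝ) : ℂ) + t * I) + beta2 c' D) /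
        ((((1 : ℝ) : ℂ) + t * I) + beta2 c' D)) with hIpart
  set V := calR2 c' χ 1 * (d : ℂ) ^ beta1 c' D * calM2 c' χ d l (1 - beta1 c' D) +
      calR2 c' χ 2 * (d : ℂ) ^ beta2 c' D * calM2 c' χ d l (1 - beta2 c' D) with hV
  set r₃ := (deriv χ.LFunction ρt)⁻¹ *
        (riemannZeta (ρt + beta1 c' D) * calM2 c' χ d l ρt * (riemannZeta ρt)⁻¹ *
          ((d : ℂ) ^ ((ρt : ℂ) - 1))⁻¹ *
          (((P4 D : ℝ) : ℂ) ^ ((ρt : ℂ) - 1 + beta2 c' D) *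
            GaussWeight.omega1 (ell D ^ 30) ((ρt : ℂ) - 1 + beta2 c' D) / ((ρt : ℂ) - 1 + beta2 c' D)))
    with hr₃
  have htri : ‖Ipart - V‖ ≤ ‖Ipart - (V + r₃)‖ + ‖r₃‖ := by
    have : Ipart - V = (Ipart - (V + r₃)) + r₃ := by ring
    rw [this]; exact norm_add_le _ _
  linarith [htri, key, hR3]

end Literature.NumberTheory.LFunctions.Zhang2022.Eq1610
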